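import Literature.Combinatorics.StablePolynomials.Symmetrization
import HarnessLib

/-!
# The symmetry index and the cyclic averages `T_σ` (Borcea–Brändén II, Appendix, Lemma 9.1)

J. Borcea, P. Brändén, *The Lee–Yang and Pólya–Schur programs. II. Theory of stable polynomials and
applications*, Comm. Pure Appl. Math. 62 (2009) 1595–1631 (arXiv:0809.3087), §9 Appendix:

> For `σ ∈ 𝔖_n` define an operator `T_σ : ℂ[z_1,…,z_n] → ℂ[z_1,…,z_n]` by
> `T_σ(f) = |⟨σ⟩|⁻¹ Σ_{τ ∈ ⟨σ⟩} τ(f)`, where `⟨σ⟩` is the subgroup of `𝔖_n` generated by `σ`. Given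
> `α, β ∈ ℕⁿ` we write `α ∼ β` if `α` is a rearrangement of `β`. If `f(z) = Σ_α a(α) z^α ∈ ℝ[z_1,…,z_n]`
> let the *symmetry index* of `f` be `si(f) = Σ_{α ∼ β} |a(α) - a(β)|`. For `f = g + ih` with
> `g, h ∈ ℝ[z_1,…,z_n]` we define its symmetry index as `si(f) = si(g) + si(h)`. Hence `si(f) = 0` if
> and only if `f` is symmetric.
>
> **Lemma 9.1.** Let `σ ∈ 𝔖_n` and `f(z) = Σ_α a(α) z^α ∈ ℂ[z_1,…,z_n]`. Then `si(T_σ(f)) ≤ si(f)`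
> with equality if and only if `a(σ(α)) = a(α)` for all `α ∈ ℕⁿ`, i.e., `T_σ(f) = f`.
>
> *Proof.* […] Since `si(τ(f)) = si(f)` for all `τ ∈ 𝔖_n` we have by the triangle inequality
> `si(T_σ(f)) = Σ_{α∼β} |⟨σ⟩|⁻¹ |Σ_{τ∈⟨σ⟩} a(τ(α)) - a(τ(β))| ≤ Σ_{α∼β} |⟨σ⟩|⁻¹ Σ_{τ∈⟨σ⟩}
> |a(τ(α)) - a(τ(β))| = |⟨σ⟩|⁻¹ Σ_{τ∈⟨σ⟩} si(τ(f)) = si(f)` […]. If equality holds let `β = σ(α)`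
> […]. Hence `α ↦ a(α)` is constant on `⟨σ⟩`-orbits, which completes the proof.

This file formalizes the operator `T_σ` (`cyclicAverage`), the symmetry index (`symmIndex`) and
Lemma 9.1 with its equality case (`symmIndex_cyclicAverage_le`, `symmIndex_cyclicAverage_eq_iff`,
`symmIndex_cyclicAverage_lt`).

## Conventions

* The action `σ(f)(z_1,…,z_n) = f(z_{σ(1)},…,z_{σ(n)})` is `rename ⇑σ f` (as in `Symmetrization.lean`);
  on exponent vectors `α : σ →₀ ℕ` a permutation acts by `Finsupp.mapDomain ⇑π α` (so that
  `coeff (π·α) (π(f)) = coeff α f`, Mathlib's `coeff_rename_mapDomain`). The set of rearrangements of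
  `α` is the finite set `exponentOrbit α = {π·α : π ∈ 𝔖_σ}`.
* The printed sum `Σ_{α∼β}` runs over all pairs of rearrangements; only pairs meeting the support of
  `f` contribute. We sum over `α ∈ S`, `β ∈ exponentOrbit α` for a finite index set `S`
  (`symmIndexOn S f`) and take for `si(f)` the canonical choice `S = symmSupport f`, the union of the
  orbits of the support (`symmIndex f`); `symmIndexOn_eq_symmIndex` shows that every `S ⊇ symmSupport f`
  gives the same value, which is how `si(T_σ f)` and `si(f)` are compared over a common index set.
* For complex coefficients the printed `si(g + ih) = si(g) + si(h)` is realized by measuring a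
  difference of coefficients `w = a(α) - a(β)` by `reImNorm w = |Re w| + |Im w|`
  (`symmIndex_map_algebraMap` recovers the printed real formula for real polynomials).
* Lemma 9.2 of the Appendix (`Sym(f)` is a locally uniform *limit* of iterated transposition averages)
  is not restated here: `MvPolynomial` carries no topology in Mathlib, and the tree already contains
  the exact finite substitute `seqSymmetrization_toList_univ` (`Symmetrization.lean`), which writes
  `Sym(f)` as a finite composite of partial symmetrizations. The strict inequality
  `symmIndex_cyclicAverage_lt` is the form of Lemma 9.1 used in the printed proof of Lemma 9.2.

## Main results (namespace `Literature.Combinatorics.StablePolynomials`)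

* `coeff_rename_perm`, `rename_perm_eq_self_iff` — coefficients of `π(f)`; `π(f) = f ↔ a(π·α) = a(α)`.
* `exponentOrbit`, `symmSupport` — rearrangements of an exponent vector; the symmetrized support.
* `cyclicAverage` — `T_σ`; `coeff_cyclicAverage`, `rename_cyclicAverage`, `cyclicAverage_eq_self_iff`
  (`T_σ f = f ↔ σ(f) = f`).
* `reImNorm`, `symmIndexOn`, `symmIndex` — the symmetry index; `symmIndex_rename` (`si(τ f) = si f`),
  `symmIndex_eq_zero_iff` (`si f = 0 ↔ f` is symmetric).
* `symmIndex_cyclicAverage_le`, `symmIndex_cyclicAverage_eq_iff`, `symmIndex_cyclicAverage_eq_iff'`,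
  `symmIndex_cyclicAverage_lt`, `BorceaBranden_symmetryIndex_lemma` — **Lemma 9.1**.

## References

* J. Borcea, P. Brändén, *The Lee–Yang and Pólya–Schur programs. II*, Comm. Pure Appl. Math. 62
  (2009) 1595–1631, §9 Appendix, Lemma 9.1 (and Lemma 9.2 for context). [BorceaBranden2009II]
-/

noncomputable section

open MvPolynomial Finset

namespace Literature.Combinatorics.StablePolynomials

variable {σ : Type*}

/-! ## §1 Permutations acting on exponent vectors and on coefficients -/

section PermAction

variable {R : Type*} [CommSemiring R]

/-- `(π π')·α = π·(π'·α)` for the action `π·α = Finsupp.mapDomain π α` of `𝔖_σ` on exponent vectors.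
[cite: BorceaBranden2009II, §9 Appendix (the action `σ(α)` of `𝔖_n` on `ℕⁿ`)] -/
theorem mapDomain_perm_mul (π π' : Equiv.Perm σ) (α : σ →₀ ℕ) :
    Finsupp.mapDomain (⇑(π * π')) α = Finsupp.mapDomain (⇑π) (Finsupp.mapDomain (⇑π') α) := by
  rw [Equiv.Perm.coe_mul, Finsupp.mapDomain_comp]

/-- `1·α = α`. [cite: BorceaBranden2009II, §9 Appendix (the action of `𝔖_n` on `ℕⁿ`)] -/
theorem mapDomain_perm_one (α : σ →₀ ℕ) : Finsupp.mapDomain (⇑(1 : Equiv.Perm σ)) α = α := by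
  rw [Equiv.Perm.coe_one, Finsupp.mapDomain_id]

/-- `π⁻¹·(π·α) = α`. [cite: BorceaBranden2009II, §9 Appendix (the action of `𝔖_n` on `ℕⁿ`)] -/
theorem mapDomain_perm_inv_mapDomain (π : Equiv.Perm σ) (α : σ →₀ ℕ) :
    Finsupp.mapDomain (⇑π⁻¹) (Finsupp.mapDomain (⇑π) α) = α := by
  rw [← mapDomain_perm_mul, inv_mul_cancel, mapDomain_perm_one]

/-- `π·(π⁻¹·α) = α`. [cite: BorceaBranden2009II, §9 Appendix (the action of `𝔖_n` on `ℕⁿ`)] -/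
theorem mapDomain_perm_mapDomain_inv (π : Equiv.Perm σ) (α : σ →₀ ℕ) :
    Finsupp.mapDomain (⇑π) (Finsupp.mapDomain (⇑π⁻¹) α) = α := by
  rw [← mapDomain_perm_mul, mul_inv_cancel, mapDomain_perm_one]

/-- `π·α` is a rearrangement of `α`: `(π·α)_{π(i)} = α_i`. [cite: BorceaBranden2009II, §9 Appendix
("`α ∼ β` if `α` is a rearrangement of `β`")] -/
theorem mapDomain_perm_apply (π : Equiv.Perm σ) (α : σ →₀ ℕ) (i : σ) :
    Finsupp.mapDomain (⇑π) α (π i) = α i :=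
  Finsupp.mapDomain_apply π.injective α i

/-- The coefficient of `z^{π·α}` in `π(f)` is the coefficient of `z^α` in `f`.
[cite: BorceaBranden2009II, §9 Appendix (coefficients `a(τ(α))` of `τ(f)`)] -/
theorem coeff_mapDomain_rename_perm (π : Equiv.Perm σ) (f : MvPolynomial σ R) (α : σ →₀ ℕ) :
    coeff (Finsupp.mapDomain (⇑π) α) (rename (⇑π) f) = coeff α f :=
  coeff_rename_mapDomain _ π.injective _ _

/-- The coefficient of `z^α` in `π(f)` is the coefficient of `z^{π⁻¹·α}` in `f`.
[cite: BorceaBranden2009II, §9 Appendix (coefficients `a(τ(α))` of `τ(f)`)] -/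
theorem coeff_rename_perm (π : Equiv.Perm σ) (f : MvPolynomial σ R) (α : σ →₀ ℕ) :
    coeff α (rename (⇑π) f) = coeff (Finsupp.mapDomain (⇑π⁻¹) α) f := by
  conv_lhs => rw [← mapDomain_perm_mapDomain_inv π α]
  exact coeff_rename_mapDomain _ π.injective _ _

/-- `π(f) = f` iff `a(π·α) = a(α)` for all `α`. [cite: BorceaBranden2009II, §9 Appendix, Lemma 9.1
("`a(σ(α)) = a(α)` for all `α ∈ ℕⁿ`")] -/
theorem rename_perm_eq_self_iff (π : Equiv.Perm σ) (f : MvPolynomial σ R) :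
    rename (⇑π) f = f ↔ ∀ α : σ →₀ ℕ, coeff (Finsupp.mapDomain (⇑π) α) f = coeff α f := by
  constructor
  · intro h α
    have key := coeff_mapDomain_rename_perm π f α
    rwa [h] at key
  · intro h
    ext α
    rw [coeff_rename_perm, ← h (Finsupp.mapDomain (⇑π⁻¹) α), mapDomain_perm_mapDomain_inv]

/-- If `π(f) = f` then `π⁻¹(f) = f`. [cite: BorceaBranden2009II, §9 Appendix (the subgroup `⟨σ⟩`)] -/
theorem rename_perm_inv_eq_self {π : Equiv.Perm σ} {f : MvPolynomial σ R} (h : rename (⇑π) f = f) :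
    rename (⇑π⁻¹) f = f := by
  conv_lhs => rw [← h]
  rw [← rename_perm_mul, inv_mul_cancel, rename_perm_one]

/-- If `π(f) = f` then `πⁿ(f) = f`. [cite: BorceaBranden2009II, §9 Appendix (the subgroup `⟨σ⟩`)] -/
theorem rename_perm_pow_eq_self {π : Equiv.Perm σ} {f : MvPolynomial σ R} (h : rename (⇑π) f = f)
    (n : ℕ) : rename (⇑(π ^ n)) f = f := by
  induction n with
  | zero => rw [pow_zero, rename_perm_one]
  | succ n ih => rw [pow_succ, rename_perm_mul, h, ih]

/-- If `π(f) = f` then `πⁿ(f) = f` for `n ∈ ℤ`. [cite: BorceaBranden2009II, §9 Appendix (the subgroup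
`⟨σ⟩`)] -/
theorem rename_perm_zpow_eq_self {π : Equiv.Perm σ} {f : MvPolynomial σ R} (h : rename (⇑π) f = f)
    (n : ℤ) : rename (⇑(π ^ n)) f = f := by
  cases n with
  | ofNat n =>
    rw [Int.ofNat_eq_natCast, zpow_natCast]
    exact rename_perm_pow_eq_self h n
  | negSucc n =>
    rw [zpow_negSucc]
    exact rename_perm_inv_eq_self (rename_perm_pow_eq_self h _)

/-- If `σ(f) = f` then `τ(f) = f` for every `τ ∈ ⟨σ⟩`. [cite: BorceaBranden2009II, §9 Appendix
(the subgroup `⟨σ⟩` generated by `σ`)] -/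
theorem rename_eq_self_of_mem_zpowers {π τ : Equiv.Perm σ} {f : MvPolynomial σ R}
    (h : rename (⇑π) f = f) (hτ : τ ∈ Subgroup.zpowers π) : rename (⇑τ) f = f := by
  obtain ⟨n, rfl⟩ := Subgroup.mem_zpowers_iff.1 hτ
  exact rename_perm_zpow_eq_self h n

end PermAction

/-! ## §2 Rearrangements: orbits of exponent vectors and the symmetrized support -/

section Orbit

variable [Fintype σ] [DecidableEq σ]

/-- The rearrangements of the exponent vector `α`: `{β : β ∼ α} = {π·α : π ∈ 𝔖_σ}`.
[cite: BorceaBranden2009II, §9 Appendix ("`α ∼ β` if `α` is a rearrangement of `β`")] -/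
def exponentOrbit (α : σ →₀ ℕ) : Finset (σ →₀ ℕ) :=
  (Finset.univ : Finset (Equiv.Perm σ)).image fun π : Equiv.Perm σ => Finsupp.mapDomain (⇑π) α

/-- `β ∼ α` iff `β = π·α` for some `π`. [cite: BorceaBranden2009II, §9 Appendix (definition of `∼`)] -/
theorem mem_exponentOrbit {α β : σ →₀ ℕ} :
    β ∈ exponentOrbit α ↔ ∃ π : Equiv.Perm σ, Finsupp.mapDomain (⇑π) α = β := by
  simp only [exponentOrbit, Finset.mem_image, Finset.mem_univ, true_and]

/-- `π·α ∼ α`. [cite: BorceaBranden2009II, §9 Appendix (definition of `∼`)] -/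
theorem mapDomain_mem_exponentOrbit (π : Equiv.Perm σ) (α : σ →₀ ℕ) :
    Finsupp.mapDomain (⇑π) α ∈ exponentOrbit α :=
  mem_exponentOrbit.2 ⟨π, rfl⟩

/-- `α ∼ α`. [cite: BorceaBranden2009II, §9 Appendix (definition of `∼`)] -/
theorem self_mem_exponentOrbit (α : σ →₀ ℕ) : α ∈ exponentOrbit α := by
  simpa only [mapDomain_perm_one] using mapDomain_mem_exponentOrbit 1 α

/-- `π·α` has the same rearrangements as `α`. [cite: BorceaBranden2009II, §9 Appendix (definition of
`∼`)] -/
theorem exponentOrbit_mapDomain (π : Equiv.Perm σ) (α : σ →₀ ℕ) :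
    exponentOrbit (Finsupp.mapDomain (⇑π) α) = exponentOrbit α := by
  ext β
  simp only [mem_exponentOrbit]
  constructor
  · rintro ⟨π', rfl⟩
    exact ⟨π' * π, mapDomain_perm_mul π' π α⟩
  · rintro ⟨π', rfl⟩
    exact ⟨π' * π⁻¹, by rw [mapDomain_perm_mul, mapDomain_perm_inv_mapDomain]⟩

/-- `∼` is an equivalence: equivalent exponent vectors have the same rearrangements.
[cite: BorceaBranden2009II, §9 Appendix (definition of `∼`)] -/
theorem exponentOrbit_eq_of_mem {α β : σ →₀ ℕ} (h : β ∈ exponentOrbit α) :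
    exponentOrbit β = exponentOrbit α := by
  obtain ⟨π, rfl⟩ := mem_exponentOrbit.1 h
  exact exponentOrbit_mapDomain π α

/-- `∼` is symmetric. [cite: BorceaBranden2009II, §9 Appendix (definition of `∼`)] -/
theorem mem_exponentOrbit_comm {α β : σ →₀ ℕ} : β ∈ exponentOrbit α ↔ α ∈ exponentOrbit β := by
  constructor
  · intro h
    rw [exponentOrbit_eq_of_mem h]
    exact self_mem_exponentOrbit α
  · intro h
    rw [exponentOrbit_eq_of_mem h]
    exact self_mem_exponentOrbit β

variable {R : Type*} [CommSemiring R]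

/-- The symmetrized support of `f`: all rearrangements of exponent vectors in the support of `f` (a
finite, permutation-invariant index set outside of which no pair `α ∼ β` contributes to `si(f)`).
[cite: BorceaBranden2009II, §9 Appendix (the sum `Σ_{α∼β}` defining `si`)] -/
def symmSupport (f : MvPolynomial σ R) : Finset (σ →₀ ℕ) :=
  f.support.biUnion exponentOrbit

/-- Membership in the symmetrized support. [cite: BorceaBranden2009II, §9 Appendix (the sum
`Σ_{α∼β}`)] -/
theorem mem_symmSupport {f : MvPolynomial σ R} {α : σ →₀ ℕ} :
    α ∈ symmSupport f ↔ ∃ β ∈ f.support, α ∈ exponentOrbit β :=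
  Finset.mem_biUnion

/-- `supp f ⊆ symmSupport f`. [cite: BorceaBranden2009II, §9 Appendix (the sum `Σ_{α∼β}`)] -/
theorem support_subset_symmSupport (f : MvPolynomial σ R) : f.support ⊆ symmSupport f :=
  fun α h => mem_symmSupport.2 ⟨α, h, self_mem_exponentOrbit α⟩

/-- The symmetrized support is a union of orbits. [cite: BorceaBranden2009II, §9 Appendix (the sum
`Σ_{α∼β}`)] -/
theorem exponentOrbit_subset_symmSupport {f : MvPolynomial σ R} {α : σ →₀ ℕ}
    (h : α ∈ symmSupport f) : exponentOrbit α ⊆ symmSupport f := by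
  intro β hβ
  obtain ⟨γ, hγ, hα⟩ := mem_symmSupport.1 h
  refine mem_symmSupport.2 ⟨γ, hγ, ?_⟩
  rw [← exponentOrbit_eq_of_mem hα]
  exact hβ

/-- The symmetrized support is permutation invariant. [cite: BorceaBranden2009II, §9 Appendix (the
sum `Σ_{α∼β}`)] -/
theorem mapDomain_mem_symmSupport_iff (π : Equiv.Perm σ) {f : MvPolynomial σ R} {α : σ →₀ ℕ} :
    Finsupp.mapDomain (⇑π) α ∈ symmSupport f ↔ α ∈ symmSupport f :=
  ⟨fun h => exponentOrbit_subset_symmSupport h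
      (mem_exponentOrbit_comm.1 (mapDomain_mem_exponentOrbit π α)),
    fun h => exponentOrbit_subset_symmSupport h (mapDomain_mem_exponentOrbit π α)⟩

/-- The symmetrized support is permutation invariant (the form used for reindexing).
[cite: BorceaBranden2009II, §9 Appendix (the sum `Σ_{α∼β}`)] -/
theorem symmSupport_invariant (f : MvPolynomial σ R) (π : Equiv.Perm σ) (α : σ →₀ ℕ)
    (h : α ∈ symmSupport f) : Finsupp.mapDomain (⇑π) α ∈ symmSupport f :=
  (mapDomain_mem_symmSupport_iff π).2 h

/-- Coefficients vanish off the symmetrized support. [cite: BorceaBranden2009II, §9 Appendix (the sum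
`Σ_{α∼β}`)] -/
theorem coeff_eq_zero_of_not_mem_symmSupport {f : MvPolynomial σ R} {α : σ →₀ ℕ}
    (h : α ∉ symmSupport f) : coeff α f = 0 :=
  notMem_support_iff.1 fun h' => h (support_subset_symmSupport f h')

/-- A permutation-invariant set containing the support contains the symmetrized support.
[cite: BorceaBranden2009II, §9 Appendix (the sum `Σ_{α∼β}`)] -/
theorem symmSupport_subset_of_support_subset {f : MvPolynomial σ R} {S : Finset (σ →₀ ℕ)}
    (hS : ∀ (π : Equiv.Perm σ) (α : σ →₀ ℕ), α ∈ S → Finsupp.mapDomain (⇑π) α ∈ S)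
    (hf : f.support ⊆ S) : symmSupport f ⊆ S := by
  intro α hα
  obtain ⟨β, hβ, hαβ⟩ := mem_symmSupport.1 hα
  obtain ⟨π, rfl⟩ := mem_exponentOrbit.1 hαβ
  exact hS π β (hf hβ)

/-- `supp π(f) ⊆ symmSupport f`. [cite: BorceaBranden2009II, §9 Appendix ("`si(τ(f)) = si(f)`")] -/
theorem support_rename_perm_subset_symmSupport (π : Equiv.Perm σ) (f : MvPolynomial σ R) :
    (rename (⇑π) f).support ⊆ symmSupport f := by
  intro α hα
  rw [mem_support_iff, coeff_rename_perm] at hα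
  have key := support_subset_symmSupport f (mem_support_iff.2 hα)
  rwa [mapDomain_mem_symmSupport_iff] at key

/-- `symmSupport π(f) ⊆ symmSupport f`. [cite: BorceaBranden2009II, §9 Appendix ("`si(τ(f)) = si(f)`")] -/
theorem symmSupport_rename_perm_subset (π : Equiv.Perm σ) (f : MvPolynomial σ R) :
    symmSupport (rename (⇑π) f) ⊆ symmSupport f :=
  symmSupport_subset_of_support_subset (fun π' α h => symmSupport_invariant f π' α h)
    (support_rename_perm_subset_symmSupport π f)

end Orbit

/-! ## §3 The cyclic averages `T_σ` -/

section CyclicAverage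

variable [Fintype σ] [DecidableEq σ] {K : Type*} [Field K]

/-- **The operator `T_σ`**: `T_σ(f) = |⟨σ⟩|⁻¹ Σ_{τ ∈ ⟨σ⟩} τ(f)`, the average of `f` over the cyclic
subgroup `⟨σ⟩ = Subgroup.zpowers σ` of `𝔖_σ` (`|⟨σ⟩| = orderOf σ`, `Fintype.card_zpowers`).
[cite: BorceaBranden2009II, §9 Appendix (definition of `T_σ`)] -/
def cyclicAverage (s : Equiv.Perm σ) (f : MvPolynomial σ K) : MvPolynomial σ K :=
  ((Fintype.card (Subgroup.zpowers s) : K)⁻¹) •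
    ∑ τ : Subgroup.zpowers s, rename (⇑(τ : Equiv.Perm σ)) f

/-- `|⟨σ⟩|` is the order of `σ`. [cite: BorceaBranden2009II, §9 Appendix ("where `k` is the order of
`σ`")] -/
theorem card_zpowers_eq_orderOf (s : Equiv.Perm σ) :
    Fintype.card (Subgroup.zpowers s) = orderOf s :=
  Fintype.card_zpowers

/-- **Coefficients of `T_σ(f)`**: `coeff α (T_σ f) = |⟨σ⟩|⁻¹ Σ_{τ∈⟨σ⟩} a(τ·α)`.
[cite: BorceaBranden2009II, §9 Appendix, proof of Lemma 9.1 (first displayed line)] -/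
theorem coeff_cyclicAverage (s : Equiv.Perm σ) (f : MvPolynomial σ K) (α : σ →₀ ℕ) :
    coeff α (cyclicAverage s f) = ((Fintype.card (Subgroup.zpowers s) : K)⁻¹) *
      ∑ τ : Subgroup.zpowers s, coeff (Finsupp.mapDomain (⇑(τ : Equiv.Perm σ)) α) f := by
  rw [cyclicAverage, coeff_smul, coeff_sum, smul_eq_mul]
  congr 1
  refine Fintype.sum_equiv (Equiv.inv (Subgroup.zpowers s)) _ _ fun τ => ?_
  rw [coeff_rename_perm, Equiv.inv_apply, Subgroup.coe_inv]

/-- `τ(T_σ f) = T_σ f` for `τ ∈ ⟨σ⟩`. [cite: BorceaBranden2009II, §9 Appendix (definition of `T_σ`)] -/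
theorem rename_cyclicAverage_of_mem {s τ : Equiv.Perm σ} (hτ : τ ∈ Subgroup.zpowers s)
    (f : MvPolynomial σ K) : rename (⇑τ) (cyclicAverage s f) = cyclicAverage s f := by
  rw [cyclicAverage, map_smul, map_sum]
  congr 1
  simp_rw [← rename_perm_mul]
  exact Fintype.sum_equiv (Equiv.mulLeft (⟨τ, hτ⟩ : Subgroup.zpowers s)) _ _ fun x => rfl

/-- `σ(T_σ f) = T_σ f`. [cite: BorceaBranden2009II, §9 Appendix (definition of `T_σ`)] -/
theorem rename_cyclicAverage (s : Equiv.Perm σ) (f : MvPolynomial σ K) :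
    rename (⇑s) (cyclicAverage s f) = cyclicAverage s f :=
  rename_cyclicAverage_of_mem (Subgroup.mem_zpowers s) f

/-- If `σ(f) = f` then `T_σ f = f`. [cite: BorceaBranden2009II, §9 Appendix, Lemma 9.1 ("i.e.,
`T_σ(f) = f`")] -/
theorem cyclicAverage_eq_self_of_rename_eq [CharZero K] {s : Equiv.Perm σ} {f : MvPolynomial σ K}
    (h : rename (⇑s) f = f) : cyclicAverage s f = f := by
  rw [cyclicAverage]
  have key : ∀ τ : Subgroup.zpowers s, rename (⇑(τ : Equiv.Perm σ)) f = f :=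
    fun τ => rename_eq_self_of_mem_zpowers h τ.2
  simp_rw [key, Finset.sum_const, Finset.card_univ, ← Nat.cast_smul_eq_nsmul K, smul_smul]
  rw [inv_mul_cancel₀ (Nat.cast_ne_zero.2 Fintype.card_ne_zero), one_smul]

/-- **`T_σ f = f ↔ σ(f) = f`.** [cite: BorceaBranden2009II, §9 Appendix, Lemma 9.1 ("`a(σ(α)) = a(α)`
for all `α`, i.e., `T_σ(f) = f`")] -/
theorem cyclicAverage_eq_self_iff [CharZero K] (s : Equiv.Perm σ) (f : MvPolynomial σ K) :
    cyclicAverage s f = f ↔ rename (⇑s) f = f := by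
  refine ⟨fun h => ?_, cyclicAverage_eq_self_of_rename_eq⟩
  calc rename (⇑s) f = rename (⇑s) (cyclicAverage s f) := by rw [h]
    _ = cyclicAverage s f := rename_cyclicAverage s f
    _ = f := h

/-- `T_σ f = f ↔ a(σ·α) = a(α)` for all `α`. [cite: BorceaBranden2009II, §9 Appendix, Lemma 9.1] -/
theorem cyclicAverage_eq_self_iff_coeff [CharZero K] (s : Equiv.Perm σ) (f : MvPolynomial σ K) :
    cyclicAverage s f = f ↔ ∀ α : σ →₀ ℕ, coeff (Finsupp.mapDomain (⇑s) α) f = coeff α f :=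
  (cyclicAverage_eq_self_iff s f).trans (rename_perm_eq_self_iff s f)

/-- `supp (T_σ f) ⊆ symmSupport f`. [cite: BorceaBranden2009II, §9 Appendix, proof of Lemma 9.1] -/
theorem support_cyclicAverage_subset (s : Equiv.Perm σ) (f : MvPolynomial σ K) :
    (cyclicAverage s f).support ⊆ symmSupport f := by
  intro α hα
  rw [mem_support_iff, coeff_cyclicAverage] at hα
  obtain ⟨τ, -, hτ⟩ := Finset.exists_ne_zero_of_sum_ne_zero (right_ne_zero_of_mul hα)
  have key := support_subset_symmSupport f (mem_support_iff.2 hτ)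
  rwa [mapDomain_mem_symmSupport_iff] at key

/-- `symmSupport (T_σ f) ⊆ symmSupport f`. [cite: BorceaBranden2009II, §9 Appendix, proof of
Lemma 9.1] -/
theorem symmSupport_cyclicAverage_subset (s : Equiv.Perm σ) (f : MvPolynomial σ K) :
    symmSupport (cyclicAverage s f) ⊆ symmSupport f :=
  symmSupport_subset_of_support_subset (fun π α h => symmSupport_invariant f π α h)
    (support_cyclicAverage_subset s f)

end CyclicAverage

/-! ## §4 The norm `|Re w| + |Im w|` -/

section ReImNorm

/-- `reImNorm w = |Re w| + |Im w|`: the contribution of a difference of complex coefficients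
`w = a(α) - a(β)` to `si(f) = si(Re f) + si(Im f)`. [cite: BorceaBranden2009II, §9 Appendix
("for `f = g + ih` … we define its symmetry index as `si(f) = si(g) + si(h)`")] -/
def reImNorm (w : ℂ) : ℝ := |w.re| + |w.im|

/-- `reImNorm w ≥ 0`. [cite: BorceaBranden2009II, §9 Appendix (definition of `si`)] -/
theorem reImNorm_nonneg (w : ℂ) : 0 ≤ reImNorm w :=
  add_nonneg (abs_nonneg _) (abs_nonneg _)

/-- `reImNorm 0 = 0`. [cite: BorceaBranden2009II, §9 Appendix (definition of `si`)] -/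
theorem reImNorm_zero : reImNorm 0 = 0 := by
  simp [reImNorm]

/-- `reImNorm w = 0 ↔ w = 0`. [cite: BorceaBranden2009II, §9 Appendix ("`si(f) = 0` if and only if
`f` is symmetric")] -/
theorem reImNorm_eq_zero_iff {w : ℂ} : reImNorm w = 0 ↔ w = 0 := by
  constructor
  · intro h
    have h1 : |w.re| = 0 := le_antisymm (by unfold reImNorm at h; linarith [abs_nonneg w.im])
      (abs_nonneg _)
    have h2 : |w.im| = 0 := le_antisymm (by unfold reImNorm at h; linarith [abs_nonneg w.re])
      (abs_nonneg _)
    exact Complex.ext (abs_eq_zero.1 h1) (abs_eq_zero.1 h2)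
  · rintro rfl
    exact reImNorm_zero

/-- `reImNorm (-w) = reImNorm w`. [cite: BorceaBranden2009II, §9 Appendix (definition of `si`)] -/
theorem reImNorm_neg (w : ℂ) : reImNorm (-w) = reImNorm w := by
  simp [reImNorm, abs_neg]

/-- Triangle inequality. [cite: BorceaBranden2009II, §9 Appendix, proof of Lemma 9.1 ("by the
triangle inequality")] -/
theorem reImNorm_add_le (w w' : ℂ) : reImNorm (w + w') ≤ reImNorm w + reImNorm w' := by
  simp only [reImNorm, Complex.add_re, Complex.add_im]
  linarith [abs_add_le w.re w'.re, abs_add_le w.im w'.im]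

/-- Triangle inequality for finite sums. [cite: BorceaBranden2009II, §9 Appendix, proof of
Lemma 9.1 ("by the triangle inequality")] -/
theorem reImNorm_sum_le {ι : Type*} (t : Finset ι) (w : ι → ℂ) :
    reImNorm (∑ i ∈ t, w i) ≤ ∑ i ∈ t, reImNorm (w i) := by
  simp only [reImNorm, Complex.re_sum, Complex.im_sum, Finset.sum_add_distrib]
  exact add_le_add (Finset.abs_sum_le_sum_abs _ _) (Finset.abs_sum_le_sum_abs _ _)

/-- Homogeneity under non-negative real scalars. [cite: BorceaBranden2009II, §9 Appendix, proof of
Lemma 9.1 (the factor `|⟨σ⟩|⁻¹`)] -/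
theorem reImNorm_ofReal_mul {r : ℝ} (hr : 0 ≤ r) (w : ℂ) :
    reImNorm ((r : ℂ) * w) = r * reImNorm w := by
  simp only [reImNorm, Complex.re_ofReal_mul, Complex.im_ofReal_mul, abs_mul, abs_of_nonneg hr,
    mul_add]

end ReImNorm

/-! ## §5 The symmetry index -/

section SymmetryIndex

variable [Fintype σ] [DecidableEq σ]

/-- The symmetry index computed over the index set `S`:
`si_S(f) = Σ_{α ∈ S} Σ_{β ∼ α} (|Re(a(α) - a(β))| + |Im(a(α) - a(β))|)`.
[cite: BorceaBranden2009II, §9 Appendix (definition of `si`)] -/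
def symmIndexOn (S : Finset (σ →₀ ℕ)) (f : MvPolynomial σ ℂ) : ℝ :=
  ∑ α ∈ S, ∑ β ∈ exponentOrbit α, reImNorm (coeff α f - coeff β f)

/-- **The symmetry index** `si(f) = Σ_{α∼β} |a(α) - a(β)|` (for real `f`; `si(g + ih) = si(g) + si(h)`
in general), the pairs `α ∼ β` running over the symmetrized support of `f` (all other pairs contribute
`0`). [cite: BorceaBranden2009II, §9 Appendix (definition of `si`)] -/
def symmIndex (f : MvPolynomial σ ℂ) : ℝ :=
  symmIndexOn (symmSupport f) f

/-- `si_S(f) ≥ 0`. [cite: BorceaBranden2009II, §9 Appendix (definition of `si`)] -/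
theorem symmIndexOn_nonneg (S : Finset (σ →₀ ℕ)) (f : MvPolynomial σ ℂ) : 0 ≤ symmIndexOn S f :=
  Finset.sum_nonneg fun _ _ => Finset.sum_nonneg fun _ _ => reImNorm_nonneg _

/-- `si(f) ≥ 0`. [cite: BorceaBranden2009II, §9 Appendix (definition of `si`)] -/
theorem symmIndex_nonneg (f : MvPolynomial σ ℂ) : 0 ≤ symmIndex f :=
  symmIndexOn_nonneg _ f

/-- **Independence of the index set**: every finite `S ⊇ symmSupport f` computes `si(f)` (pairs
`α ∼ β` off the symmetrized support have `a(α) = a(β) = 0`). [cite: BorceaBranden2009II, §9 Appendix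
(the sum `Σ_{α∼β}` over all of `ℕⁿ`)] -/
theorem symmIndexOn_eq_symmIndex {S : Finset (σ →₀ ℕ)} {f : MvPolynomial σ ℂ}
    (hS : symmSupport f ⊆ S) : symmIndexOn S f = symmIndex f := by
  rw [symmIndex, symmIndexOn, symmIndexOn]
  symm
  refine Finset.sum_subset hS fun α _ hα => Finset.sum_eq_zero fun β hβ => ?_
  have hb : β ∉ symmSupport f :=
    fun h => hα (exponentOrbit_subset_symmSupport h (mem_exponentOrbit_comm.1 hβ))
  rw [coeff_eq_zero_of_not_mem_symmSupport hα, coeff_eq_zero_of_not_mem_symmSupport hb, sub_zero,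
    reImNorm_zero]

/-- For a real polynomial the symmetry index is the printed `Σ_{α∼β} |a(α) - a(β)|`.
[cite: BorceaBranden2009II, §9 Appendix (definition of `si` for `f ∈ ℝ[z_1,…,z_n]`)] -/
theorem symmIndex_map_algebraMap (g : MvPolynomial σ ℝ) :
    symmIndex (map (algebraMap ℝ ℂ) g) =
      ∑ α ∈ symmSupport (map (algebraMap ℝ ℂ) g), ∑ β ∈ exponentOrbit α, |coeff α g - coeff β g| := by
  simp only [symmIndex, symmIndexOn, reImNorm, coeff_map, Complex.coe_algebraMap, ← Complex.ofReal_sub,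
    Complex.ofReal_re, Complex.ofReal_im, abs_zero, add_zero]

/-- **Reindexing by a permutation**: for a permutation-invariant index set `S` and any `F`,
`Σ_{α∈S} Σ_{β∼α} F(π·α, π·β) = Σ_{α∈S} Σ_{β∼α} F(α, β)`. [cite: BorceaBranden2009II, §9 Appendix, proof
of Lemma 9.1 ("`si(τ(f)) = si(f)` for all `τ ∈ 𝔖_n`")] -/
theorem sum_exponentOrbit_comp_perm {S : Finset (σ →₀ ℕ)}
    (hS : ∀ (π : Equiv.Perm σ) (α : σ →₀ ℕ), α ∈ S → Finsupp.mapDomain (⇑π) α ∈ S)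
    (π : Equiv.Perm σ) (F : (σ →₀ ℕ) → (σ →₀ ℕ) → ℝ) :
    ∑ α ∈ S, ∑ β ∈ exponentOrbit α, F (Finsupp.mapDomain (⇑π) α) (Finsupp.mapDomain (⇑π) β) =
      ∑ α ∈ S, ∑ β ∈ exponentOrbit α, F α β := by
  have inner : ∀ α : σ →₀ ℕ,
      ∑ β ∈ exponentOrbit α, F (Finsupp.mapDomain (⇑π) α) (Finsupp.mapDomain (⇑π) β) =
        ∑ β ∈ exponentOrbit (Finsupp.mapDomain (⇑π) α), F (Finsupp.mapDomain (⇑π) α) β := by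
    intro α
    refine Finset.sum_nbij' (Finsupp.mapDomain (⇑π)) (Finsupp.mapDomain (⇑π⁻¹)) ?_ ?_ ?_ ?_ ?_
    · intro β hβ
      rw [exponentOrbit_mapDomain, ← exponentOrbit_eq_of_mem hβ]
      exact mapDomain_mem_exponentOrbit π β
    · intro β hβ
      rw [exponentOrbit_mapDomain] at hβ
      rw [← exponentOrbit_eq_of_mem hβ]
      exact mapDomain_mem_exponentOrbit π⁻¹ β
    · intro β _
      exact mapDomain_perm_inv_mapDomain π β
    · intro β _
      exact mapDomain_perm_mapDomain_inv π β
    · intro β _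
      rfl
  rw [Finset.sum_congr rfl fun α _ => inner α]
  exact Finset.sum_nbij' (Finsupp.mapDomain (⇑π)) (Finsupp.mapDomain (⇑π⁻¹))
    (fun α h => hS π α h) (fun α h => hS π⁻¹ α h)
    (fun α _ => mapDomain_perm_inv_mapDomain π α) (fun α _ => mapDomain_perm_mapDomain_inv π α)
    (fun α _ => rfl)

/-- `si_S(π(f)) = si_S(f)` for a permutation-invariant index set `S`. [cite: BorceaBranden2009II, §9
Appendix, proof of Lemma 9.1 ("`si(τ(f)) = si(f)` for all `τ ∈ 𝔖_n`")] -/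
theorem symmIndexOn_rename_perm {S : Finset (σ →₀ ℕ)}
    (hS : ∀ (π : Equiv.Perm σ) (α : σ →₀ ℕ), α ∈ S → Finsupp.mapDomain (⇑π) α ∈ S)
    (π : Equiv.Perm σ) (f : MvPolynomial σ ℂ) :
    symmIndexOn S (rename (⇑π) f) = symmIndexOn S f := by
  simp only [symmIndexOn, coeff_rename_perm]
  exact sum_exponentOrbit_comp_perm hS π⁻¹ fun α β => reImNorm (coeff α f - coeff β f)

/-- **`si(π(f)) = si(f)`.** [cite: BorceaBranden2009II, §9 Appendix, proof of Lemma 9.1 ("`si(τ(f)) =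
si(f)` for all `τ ∈ 𝔖_n`")] -/
theorem symmIndex_rename_perm (π : Equiv.Perm σ) (f : MvPolynomial σ ℂ) :
    symmIndex (rename (⇑π) f) = symmIndex f := by
  rw [← symmIndexOn_eq_symmIndex (symmSupport_rename_perm_subset π f),
    symmIndexOn_rename_perm (symmSupport_invariant f) π f, symmIndex]

/-- **`si(f) = 0` iff `f` is symmetric.** [cite: BorceaBranden2009II, §9 Appendix ("Hence `si(f) = 0`
if and only if `f` is symmetric")] -/
theorem symmIndex_eq_zero_iff (f : MvPolynomial σ ℂ) : symmIndex f = 0 ↔ f.IsSymmetric := by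
  rw [symmIndex, symmIndexOn,
    Finset.sum_eq_zero_iff_of_nonneg fun α _ => Finset.sum_nonneg fun β _ => reImNorm_nonneg _]
  simp_rw [Finset.sum_eq_zero_iff_of_nonneg fun β _ => reImNorm_nonneg _, reImNorm_eq_zero_iff,
    sub_eq_zero]
  constructor
  · intro h π
    rw [rename_perm_eq_self_iff]
    intro α
    by_cases hα : α ∈ symmSupport f
    · exact (h α hα _ (mapDomain_mem_exponentOrbit π α)).symm
    · rw [coeff_eq_zero_of_not_mem_symmSupport hα,
        coeff_eq_zero_of_not_mem_symmSupport (mt (mapDomain_mem_symmSupport_iff π).1 hα)]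
  · intro h α _ β hβ
    obtain ⟨π, rfl⟩ := mem_exponentOrbit.1 hβ
    exact ((rename_perm_eq_self_iff π f).1 (h π) α).symm

end SymmetryIndex

/-! ## §6 Lemma 9.1 -/

section Lemma91

variable [Fintype σ] [DecidableEq σ]

/-- The termwise triangle inequality behind Lemma 9.1:
`|a_T(α) - a_T(β)| ≤ |⟨σ⟩|⁻¹ Σ_{τ∈⟨σ⟩} |a(τ·α) - a(τ·β)|` for the coefficients `a_T` of `T_σ f`.
[cite: BorceaBranden2009II, §9 Appendix, proof of Lemma 9.1 (the displayed inequality)] -/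
theorem reImNorm_coeff_cyclicAverage_sub_le (s : Equiv.Perm σ) (f : MvPolynomial σ ℂ)
    (α β : σ →₀ ℕ) :
    reImNorm (coeff α (cyclicAverage s f) - coeff β (cyclicAverage s f)) ≤
      ((Fintype.card (Subgroup.zpowers s) : ℝ)⁻¹) * ∑ τ : Subgroup.zpowers s,
        reImNorm (coeff (Finsupp.mapDomain (⇑(τ : Equiv.Perm σ)) α) f -
          coeff (Finsupp.mapDomain (⇑(τ : Equiv.Perm σ)) β) f) := by
  rw [coeff_cyclicAverage, coeff_cyclicAverage, ← mul_sub, ← Finset.sum_sub_distrib,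
    show ((Fintype.card (Subgroup.zpowers s) : ℂ))⁻¹ =
      (((Fintype.card (Subgroup.zpowers s) : ℝ)⁻¹ : ℝ) : ℂ) by
      rw [Complex.ofReal_inv, Complex.ofReal_natCast],
    reImNorm_ofReal_mul (inv_nonneg.2 (Nat.cast_nonneg _))]
  exact mul_le_mul_of_nonneg_left (reImNorm_sum_le _ _) (inv_nonneg.2 (Nat.cast_nonneg _))

/-- Summing the termwise bounds over a permutation-invariant index set gives back `si_S(f)`:
`Σ_{α∈S} Σ_{β∼α} |⟨σ⟩|⁻¹ Σ_{τ∈⟨σ⟩} |a(τ·α) - a(τ·β)| = |⟨σ⟩|⁻¹ Σ_{τ∈⟨σ⟩} si_S(τ⁻¹(f)) = si_S(f)`.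
[cite: BorceaBranden2009II, §9 Appendix, proof of Lemma 9.1 (last two displayed equalities)] -/
theorem sum_exponentOrbit_average_eq {S : Finset (σ →₀ ℕ)}
    (hS : ∀ (π : Equiv.Perm σ) (α : σ →₀ ℕ), α ∈ S → Finsupp.mapDomain (⇑π) α ∈ S)
    (s : Equiv.Perm σ) (f : MvPolynomial σ ℂ) :
    ∑ α ∈ S, ∑ β ∈ exponentOrbit α, ((Fintype.card (Subgroup.zpowers s) : ℝ)⁻¹) *
        ∑ τ : Subgroup.zpowers s, reImNorm (coeff (Finsupp.mapDomain (⇑(τ : Equiv.Perm σ)) α) f -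
          coeff (Finsupp.mapDomain (⇑(τ : Equiv.Perm σ)) β) f) = symmIndexOn S f := by
  set c : ℝ := ((Fintype.card (Subgroup.zpowers s) : ℝ)⁻¹) with hc
  have key : ∀ τ : Subgroup.zpowers s,
      ∑ α ∈ S, ∑ β ∈ exponentOrbit α, reImNorm (coeff (Finsupp.mapDomain (⇑(τ : Equiv.Perm σ)) α) f -
        coeff (Finsupp.mapDomain (⇑(τ : Equiv.Perm σ)) β) f) = symmIndexOn S f :=
    fun τ => sum_exponentOrbit_comp_perm hS (τ : Equiv.Perm σ) fun α β => reImNorm (coeff α f - coeff β f)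
  have step1 : ∀ α : σ →₀ ℕ,
      ∑ β ∈ exponentOrbit α, c * ∑ τ : Subgroup.zpowers s,
        reImNorm (coeff (Finsupp.mapDomain (⇑(τ : Equiv.Perm σ)) α) f -
          coeff (Finsupp.mapDomain (⇑(τ : Equiv.Perm σ)) β) f) =
      ∑ τ : Subgroup.zpowers s, ∑ β ∈ exponentOrbit α,
        c * reImNorm (coeff (Finsupp.mapDomain (⇑(τ : Equiv.Perm σ)) α) f -
          coeff (Finsupp.mapDomain (⇑(τ : Equiv.Perm σ)) β) f) := by
    intro α
    rw [Finset.sum_comm]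
    exact Finset.sum_congr rfl fun β _ => Finset.mul_sum _ _ _
  rw [Finset.sum_congr rfl fun α _ => step1 α, Finset.sum_comm]
  calc ∑ τ : Subgroup.zpowers s, ∑ α ∈ S, ∑ β ∈ exponentOrbit α,
        c * reImNorm (coeff (Finsupp.mapDomain (⇑(τ : Equiv.Perm σ)) α) f -
          coeff (Finsupp.mapDomain (⇑(τ : Equiv.Perm σ)) β) f)
      = ∑ τ : Subgroup.zpowers s, c * symmIndexOn S f := by
        refine Finset.sum_congr rfl fun τ _ => ?_
        rw [← key τ, Finset.mul_sum]
        exact Finset.sum_congr rfl fun α _ => (Finset.mul_sum _ _ _).symm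
    _ = symmIndexOn S f := by
        rw [Finset.sum_const, Finset.card_univ, nsmul_eq_mul, hc, ← mul_assoc,
          mul_inv_cancel₀ (Nat.cast_ne_zero.2 Fintype.card_ne_zero), one_mul]

/-- **Borcea–Brändén II, Lemma 9.1 (inequality)**: `si(T_σ(f)) ≤ si(f)`.
[cite: BorceaBranden2009II, §9 Appendix, Lemma 9.1] -/
theorem symmIndex_cyclicAverage_le (s : Equiv.Perm σ) (f : MvPolynomial σ ℂ) :
    symmIndex (cyclicAverage s f) ≤ symmIndex f := by
  rw [← symmIndexOn_eq_symmIndex (symmSupport_cyclicAverage_subset s f), symmIndex,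
    ← sum_exponentOrbit_average_eq (symmSupport_invariant f) s f]
  exact Finset.sum_le_sum fun α _ => Finset.sum_le_sum fun β _ =>
    reImNorm_coeff_cyclicAverage_sub_le s f α β

/-- `Σ_{τ∈⟨σ⟩} a(τ·(σ·α)) = Σ_{τ∈⟨σ⟩} a(τ·α)` (reindex `τ ↦ τσ`): the coefficients of `T_σ f` are
constant on `⟨σ⟩`-orbits. [cite: BorceaBranden2009II, §9 Appendix, proof of Lemma 9.1 ("`α ↦ a(α)` is
constant on `⟨σ⟩`-orbits")] -/
theorem sum_coeff_mapDomain_mapDomain_eq {K : Type*} [CommSemiring K] (s : Equiv.Perm σ)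
    (f : MvPolynomial σ K) (α : σ →₀ ℕ) :
    ∑ τ : Subgroup.zpowers s, coeff (Finsupp.mapDomain (⇑(τ : Equiv.Perm σ))
        (Finsupp.mapDomain (⇑s) α)) f =
      ∑ τ : Subgroup.zpowers s, coeff (Finsupp.mapDomain (⇑(τ : Equiv.Perm σ)) α) f := by
  refine Fintype.sum_equiv (Equiv.mulRight (⟨s, Subgroup.mem_zpowers s⟩ : Subgroup.zpowers s)) _ _
    fun τ => ?_
  rw [Equiv.coe_mulRight, Subgroup.coe_mul, mapDomain_perm_mul]

/-- **Borcea–Brändén II, Lemma 9.1 (equality case, the substantial direction)**: if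
`si(T_σ(f)) = si(f)` then `a(σ·α) = a(α)` for all `α`. [cite: BorceaBranden2009II, §9 Appendix,
Lemma 9.1 and its proof (condition (A), "let `β = σ(α)`")] -/
theorem coeff_mapDomain_eq_of_symmIndex_cyclicAverage_eq {s : Equiv.Perm σ} {f : MvPolynomial σ ℂ}
    (h : symmIndex (cyclicAverage s f) = symmIndex f) (α : σ →₀ ℕ) :
    coeff (Finsupp.mapDomain (⇑s) α) f = coeff α f := by
  by_cases hα : α ∈ symmSupport f
  swap
  · rw [coeff_eq_zero_of_not_mem_symmSupport hα,
      coeff_eq_zero_of_not_mem_symmSupport (mt (mapDomain_mem_symmSupport_iff s).1 hα)]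
  rw [← symmIndexOn_eq_symmIndex (symmSupport_cyclicAverage_subset s f), symmIndex,
    ← sum_exponentOrbit_average_eq (symmSupport_invariant f) s f, symmIndexOn] at h
  have hle : ∀ γ ∈ symmSupport f,
      ∑ β ∈ exponentOrbit γ, reImNorm (coeff γ (cyclicAverage s f) - coeff β (cyclicAverage s f)) ≤
        ∑ β ∈ exponentOrbit γ, ((Fintype.card (Subgroup.zpowers s) : ℝ)⁻¹) *
          ∑ τ : Subgroup.zpowers s, reImNorm (coeff (Finsupp.mapDomain (⇑(τ : Equiv.Perm σ)) γ) f -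
            coeff (Finsupp.mapDomain (⇑(τ : Equiv.Perm σ)) β) f) :=
    fun γ _ => Finset.sum_le_sum fun β _ => reImNorm_coeff_cyclicAverage_sub_le s f γ β
  have h1 := (Finset.sum_eq_sum_iff_of_le hle).1 h α hα
  have h2 := (Finset.sum_eq_sum_iff_of_le fun β _ =>
    reImNorm_coeff_cyclicAverage_sub_le s f α β).1 h1 (Finsupp.mapDomain (⇑s) α)
    (mapDomain_mem_exponentOrbit s α)
  have hzero : coeff α (cyclicAverage s f) - coeff (Finsupp.mapDomain (⇑s) α) (cyclicAverage s f) = 0 := by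
    rw [coeff_cyclicAverage, coeff_cyclicAverage, sum_coeff_mapDomain_mapDomain_eq, sub_self]
  rw [hzero, reImNorm_zero, eq_comm, mul_eq_zero, inv_eq_zero, Nat.cast_eq_zero] at h2
  have h3 := (Finset.sum_eq_zero_iff_of_nonneg fun τ _ => reImNorm_nonneg _).1
    (h2.resolve_left Fintype.card_ne_zero) 1 (Finset.mem_univ _)
  rw [reImNorm_eq_zero_iff, sub_eq_zero, OneMemClass.coe_one, mapDomain_perm_one,
    mapDomain_perm_one] at h3
  exact h3.symm

/-- **Borcea–Brändén II, Lemma 9.1 (equality case)**: `si(T_σ(f)) = si(f)` iff `a(σ·α) = a(α)` for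
all `α ∈ ℕⁿ`. [cite: BorceaBranden2009II, §9 Appendix, Lemma 9.1] -/
theorem symmIndex_cyclicAverage_eq_iff (s : Equiv.Perm σ) (f : MvPolynomial σ ℂ) :
    symmIndex (cyclicAverage s f) = symmIndex f ↔
      ∀ α : σ →₀ ℕ, coeff (Finsupp.mapDomain (⇑s) α) f = coeff α f :=
  ⟨coeff_mapDomain_eq_of_symmIndex_cyclicAverage_eq, fun h => by
    rw [cyclicAverage_eq_self_of_rename_eq ((rename_perm_eq_self_iff s f).2 h)]⟩

/-- **Borcea–Brändén II, Lemma 9.1 (equality case, operator form)**: `si(T_σ(f)) = si(f)` iff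
`T_σ(f) = f`. [cite: BorceaBranden2009II, §9 Appendix, Lemma 9.1 ("i.e., `T_σ(f) = f`")] -/
theorem symmIndex_cyclicAverage_eq_iff' (s : Equiv.Perm σ) (f : MvPolynomial σ ℂ) :
    symmIndex (cyclicAverage s f) = symmIndex f ↔ cyclicAverage s f = f :=
  (symmIndex_cyclicAverage_eq_iff s f).trans (cyclicAverage_eq_self_iff_coeff s f).symm

/-- **Borcea–Brändén II, Lemma 9.1 (strict form)**: if `σ(f) ≠ f` then `si(T_σ(f)) < si(f)` (the form
invoked in the proof of Lemma 9.2: "if `τ(g) ≠ g` … then by Lemma 9.1 we have `si(T_τ(g)) < si(g)`").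
[cite: BorceaBranden2009II, §9 Appendix, Lemma 9.1 and proof of Lemma 9.2] -/
theorem symmIndex_cyclicAverage_lt {s : Equiv.Perm σ} {f : MvPolynomial σ ℂ} (h : rename (⇑s) f ≠ f) :
    symmIndex (cyclicAverage s f) < symmIndex f :=
  lt_of_le_of_ne (symmIndex_cyclicAverage_le s f) fun heq =>
    h ((cyclicAverage_eq_self_iff s f).1 ((symmIndex_cyclicAverage_eq_iff' s f).1 heq))

/-- **Borcea–Brändén II, §9 Appendix, Lemma 9.1** (as printed): for `σ ∈ 𝔖_n` and
`f = Σ_α a(α) z^α ∈ ℂ[z_1,…,z_n]`, `si(T_σ(f)) ≤ si(f)`, with equality if and only if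
`a(σ(α)) = a(α)` for all `α ∈ ℕⁿ`, i.e., `T_σ(f) = f`. [cite: BorceaBranden2009II, §9 Appendix,
Lemma 9.1] -/
theorem BorceaBranden_symmetryIndex_lemma (s : Equiv.Perm σ) (f : MvPolynomial σ ℂ) :
    symmIndex (cyclicAverage s f) ≤ symmIndex f ∧
      (symmIndex (cyclicAverage s f) = symmIndex f ↔
        ∀ α : σ →₀ ℕ, coeff (Finsupp.mapDomain (⇑s) α) f = coeff α f) ∧
      ((∀ α : σ →₀ ℕ, coeff (Finsupp.mapDomain (⇑s) α) f = coeff α f) ↔ cyclicAverage s f = f) :=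
  ⟨symmIndex_cyclicAverage_le s f, symmIndex_cyclicAverage_eq_iff s f,
    (cyclicAverage_eq_self_iff_coeff s f).symm⟩

end Lemma91

end Literature.Combinatorics.StablePolynomials

end
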